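import Mathlib
import HarnessLib
import Summits.Ventures.LatticeQCDFlow.Exactness.SphereLatticeThirdMoments
import Summits.Ventures.LatticeQCDFlow.Exactness.SphereLuscherMomentIdentity

/-!
# Reduction of the third moment of the lattice CP(N−1)/O(N) action to second-order local-field sums: `(d−1)·∫(S − S₀)³ dπ̄ = 4κ²·Σ_k ∫(S − S₀)(‖J_k‖² − ⟪J_k, x_k⟫²) dπ̄` and `∫(S − S₀)⟪J_k, x_k⟫² dπ̄ = (1/d)·∫(S − S₀)‖J_k‖² dπ̄`

HONEST FRAMING: exact (Metropolis-corrected) sampling algorithms for lattice gauge theory;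
figures of merit are autocorrelation/cost numbers at stated couplings and volumes; no
continuum-physics claim.

Venture `LatticeQCDFlow` (cell pub-lqcd), topic `Exactness`; FANOUT row 7 (`s0-cpn-null`).  NEW WORK
of the cell over the tree's `Exactness/SphereLatticeThirdMoments.lean` (this leg: site-odd
functionals have mean zero, `∫⟪J_k, x_k⟫³ dπ̄ = 0`), `Exactness/SphereLuscherMomentIdentity.lean`
(GEN-12 T3a: Green with a power weight, `∫V²(−Σ∂̃²F) = −2∫VΣ⟪∂̃S, ∂̃F⟫`),
`Exactness/SphereLatticeMoments.lean` (GEN-11: affine / rank-one quadratic site dependence),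
`Exactness/SphereActionVariance.lean` (GEN-11: `‖∂̃_kS‖² = 4κ²(‖J_k‖² − ⟪J_k, x_k⟫²)`),
`Exactness/SphereLOFlowAction.lean` (E–S eq. (13): the action is affine in each site variable,
`S(x[k ← y]) = S(x[k ← 0]) − 2κ⟪J_k, y⟫`; `−Σ∂̃²S = 2(d−1)(S − S₀)`),
`Exactness/SphereLuscherGeneratorNormEquivalence.lean` (`∂̃(S − S₀) = ∂̃S`) and
`Exactness/SphereLatticeGreen.lean` (`contDiff_update_prod`); nothing is cited as a fact.  Printed
counterpart, NAMED ONLY: M. Lüscher, Commun. Math. Phys. 293 (2010) 899, §4.2 (the constants of the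
flow-action series are the cumulants of the action); Engel–Schaefer, Comput. Phys. Commun. 182
(2011) 2107, §2 eqs. (6)–(7), (13).  This is the first half of GEN-12's typed follow-up (c) — "ċ₂ in
closed form for the E–S action on a general coupling graph"; the closed form itself is
`Exactness/SphereActionThirdMoment.lean`.

## Content (`d = dim E ≥ 2`, `Λ` finite, no self-coupling `U_nn = 0`, adjoint pairs `U_mn = U_nmᵀ`,
`π̄ = ⊗_Λ σ̄`, `S = esAction κ S₀ U = −κ Σ_n ⟪x_n, J_n⟫ + S₀`, `J_k = Σ_m U_km x_m`)

* §1 **`third_moment_eq_sum_integral_mul_norm_sq_siteGrad`** — GREEN WITH THE WEIGHT `(S − S₀)²`: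
  `(d−1)·∫(S − S₀)³ dπ̄ = Σ_k ∫(S − S₀)·‖∂̃_kS‖² dπ̄` (polarised Green, `∂̃(S − S₀)² = 2(S − S₀)∂̃S`,
  and the eigenfunction property); **`third_moment_eq_sum_integral_mul_localField`** — hence
  `= 4κ²·Σ_k ∫(S − S₀)(‖J_k‖² − ⟪J_k, x_k⟫²) dπ̄`.
* §2 **`integral_esAction_sub_mul_sq_inner_localField`** — PER SITE,
  `∫(S − S₀)⟪J_k, x_k⟫² dπ̄ = (1/d)·∫(S − S₀)‖J_k‖² dπ̄`: write `S − S₀ = G_k − 2κ⟪J_k, x_k⟫` with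
  `G_k(x) = S(x[k ← 0]) − S₀` independent of `x_k`; `⟪J_k, x_k⟫³` is odd in `x_k` and
  `⟪J_k, x_k⟫‖J_k‖²` is affine in `x_k` (both mean zero), while `G_k⟪J_k, x_k⟫²` is rank-one
  quadratic in `x_k` (`d·∫G_k⟪J_k, x_k⟫² = ∫G_k‖J_k‖²`).

NOT CLAIMED: the value of `∫(S − S₀)‖J_k‖²` (tree: `SphereLatticeThirdMoments` §3) or of the
third moment (next file); anything at flow time `t > 0`; the rung's numbers.
-/

noncomputable section

namespace Summit.Ventures.LatticeQCDFlow.Exactness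

open Function Set Metric MeasureTheory NormedSpace InnerProductSpace
open scoped RealInnerProductSpace

variable {Λ : Type*} {E : Type*} [NormedAddCommGroup E] [InnerProductSpace ℝ E]
  [FiniteDimensional ℝ E] [MeasurableSpace E] [BorelSpace E] [Fintype Λ] [DecidableEq Λ] [Nontrivial E]
  {U : Λ → Λ → (E →L[ℝ] E)}

/-! ## §1 Green with the weight `(S − S₀)²` -/

section Green

/-- **`(d−1)·∫(S − S₀)³ dπ̄ = Σ_k ∫(S − S₀)·‖∂̃_kS‖² dπ̄`**: the polarised Green identity with the
weight `(S − S₀)²` (`∂̃(S − S₀)² = 2(S − S₀)∂̃S`) against `−Σ∂̃²S = 2(d−1)(S − S₀)`. -/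
theorem third_moment_eq_sum_integral_mul_norm_sq_siteGrad (hU0 : ∀ n, U n n = 0)
    (hUadj : ∀ m n (v w : E), ⟪U m n v, w⟫ = ⟪v, U n m w⟫) (κ S₀ : ℝ) :
    ((Module.finrank ℝ E : ℝ) - 1) *
        ∫ ω, (esAction κ S₀ U (fun m => ((ω : Λ → sphere (0 : E) 1) m : E)) - S₀) ^ 3
          ∂Measure.pi (fun _ : Λ => uniformSphere (volume : Measure E)) =
      ∑ k, ∫ ω, (esAction κ S₀ U (fun m => ((ω : Λ → sphere (0 : E) 1) m : E)) - S₀) *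
        ‖siteGrad k (esAction κ S₀ U) (fun m => (ω m : E))‖ ^ 2
          ∂Measure.pi (fun _ : Λ => uniformSphere (volume : Measure E)) := by
  set μ : Measure (sphere (0 : E) 1) := uniformSphere (volume : Measure E) with hμ
  set A : (Λ → E) → ℝ := fun x => esAction κ S₀ U x - S₀ with hA
  have hS2 : ContDiff ℝ 2 (esAction κ S₀ U) := contDiff_esAction U κ S₀
  have hS1 : ContDiff ℝ 1 (esAction κ S₀ U) := contDiff_esAction U κ S₀
  have hA1 : ContDiff ℝ 1 A := hS1.sub contDiff_const
  have h := integral_pow_succ_mul_neg_luscher (S := A) hA1 hS2 1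
  have heig : ∀ ω : Λ → sphere (0 : E) 1,
      -∑ n, siteLaplacian n (esAction κ S₀ U) (fun m => (ω m : E)) =
        2 * ((Module.finrank ℝ E : ℝ) - 1) * (esAction κ S₀ U (fun m => (ω m : E)) - S₀) :=
    fun ω => neg_sum_siteLaplacian_esAction hU0 hUadj κ S₀ fun n => by simp
  have e1 : ∫ ω, (-A (fun m => ((ω : Λ → sphere (0 : E) 1) m : E))) ^ (1 + 1) *
        -∑ n, siteLaplacian n (esAction κ S₀ U) (fun m => (ω m : E)) ∂Measure.pi (fun _ : Λ => μ) =
      ∫ ω, 2 * ((Module.finrank ℝ E : ℝ) - 1) *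
        (esAction κ S₀ U (fun m => ((ω : Λ → sphere (0 : E) 1) m : E)) - S₀) ^ 3
          ∂Measure.pi (fun _ : Λ => μ) :=
    integral_congr_ae (ae_of_all _ fun ω => by
      simp only [hA]
      rw [heig ω]
      ring)
  have e2 : ∫ ω, (-A (fun m => ((ω : Λ → sphere (0 : E) 1) m : E))) ^ 1 *
        ∑ n, ⟪siteGrad n A (fun m => (ω m : E)), siteGrad n (esAction κ S₀ U) (fun m => (ω m : E))⟫
          ∂Measure.pi (fun _ : Λ => μ) =
      -∫ ω, (esAction κ S₀ U (fun m => ((ω : Λ → sphere (0 : E) 1) m : E)) - S₀) *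
        ∑ n, ‖siteGrad n (esAction κ S₀ U) (fun m => (ω m : E))‖ ^ 2
          ∂Measure.pi (fun _ : Λ => μ) := by
    rw [← integral_neg]
    refine integral_congr_ae (ae_of_all _ fun ω => ?_)
    simp only [hA, pow_one, siteGrad_sub_const, real_inner_self_eq_norm_sq, neg_mul]
  rw [e1, e2, integral_const_mul] at h
  -- `h : 2(d−1)·∫A³ = −(1+1)·(−∫A·Σ‖∂̃S‖²)`
  have hc : ∀ k, Continuous fun ω : Λ → sphere (0 : E) 1 =>
      (esAction κ S₀ U (fun m => (ω m : E)) - S₀) *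
        ‖siteGrad k (esAction κ S₀ U) (fun m => (ω m : E))‖ ^ 2 := fun k =>
    ((hS2.continuous.comp continuous_sphereConfig).sub continuous_const).mul
      ((continuous_siteGrad_sphereConfig hS1 k).norm.pow 2)
  have hsum : ∫ ω, (esAction κ S₀ U (fun m => ((ω : Λ → sphere (0 : E) 1) m : E)) - S₀) *
        ∑ n, ‖siteGrad n (esAction κ S₀ U) (fun m => (ω m : E))‖ ^ 2 ∂Measure.pi (fun _ : Λ => μ) =
      ∑ k, ∫ ω, (esAction κ S₀ U (fun m => ((ω : Λ → sphere (0 : E) 1) m : E)) - S₀) *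
        ‖siteGrad k (esAction κ S₀ U) (fun m => (ω m : E))‖ ^ 2 ∂Measure.pi (fun _ : Λ => μ) := by
    rw [← integral_finsetSum Finset.univ fun k _ => integrable_pi_of_continuous μ (hc k)]
    refine integral_congr_ae (ae_of_all _ fun ω => ?_)
    simp only [Finset.mul_sum]
  rw [← hsum]
  norm_num at h
  linarith

/-- … and with E–S's `‖∂̃_kS‖² = 4κ²(‖J_k‖² − ⟪J_k, x_k⟫²)`:
`(d−1)·∫(S − S₀)³ dπ̄ = 4κ²·Σ_k ∫(S − S₀)(‖J_k‖² − ⟪J_k, x_k⟫²) dπ̄`. -/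
theorem third_moment_eq_sum_integral_mul_localField (hU0 : ∀ n, U n n = 0)
    (hUadj : ∀ m n (v w : E), ⟪U m n v, w⟫ = ⟪v, U n m w⟫) (κ S₀ : ℝ) :
    ((Module.finrank ℝ E : ℝ) - 1) *
        ∫ ω, (esAction κ S₀ U (fun m => ((ω : Λ → sphere (0 : E) 1) m : E)) - S₀) ^ 3
          ∂Measure.pi (fun _ : Λ => uniformSphere (volume : Measure E)) =
      4 * κ ^ 2 * ∑ k, ∫ ω, (esAction κ S₀ U (fun m => ((ω : Λ → sphere (0 : E) 1) m : E)) - S₀) *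
        (‖localField U k (fun m => (ω m : E))‖ ^ 2 -
          ⟪localField U k (fun m => (ω m : E)), ((ω k : sphere (0 : E) 1) : E)⟫ ^ 2)
          ∂Measure.pi (fun _ : Λ => uniformSphere (volume : Measure E)) := by
  rw [third_moment_eq_sum_integral_mul_norm_sq_siteGrad hU0 hUadj κ S₀, Finset.mul_sum]
  refine Finset.sum_congr rfl fun k _ => ?_
  rw [← integral_const_mul]
  refine integral_congr_ae (ae_of_all _ fun ω => ?_)
  dsimp only
  rw [norm_sq_siteGrad_esAction hU0 hUadj κ S₀ (fun n => by simp) k]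
  ring

end Green

/-! ## §2 Per site: `∫(S − S₀)⟪J_k, x_k⟫² dπ̄ = (1/d)·∫(S − S₀)‖J_k‖² dπ̄` -/

section PerSite

/-- **`∫ (S − S₀)·⟪J_k, x_k⟫² dπ̄ = (∫ (S − S₀)·‖J_k‖² dπ̄)/d`** (no self-coupling, adjoint pairs,
`d ≥ 2`).  With `G_k(x) = S(x[k ← 0]) − S₀` (independent of `x_k`) one has
`S − S₀ = G_k − 2κ⟪J_k, x_k⟫` (the action is affine in each site); `⟪J_k, x_k⟫³` is odd in `x_k`
and `⟪J_k, x_k⟫‖J_k‖²` is affine in `x_k` (both mean zero), while `G_k⟪J_k, x_k⟫²` is rank-one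
quadratic in `x_k`: `d·∫G_k⟪J_k, x_k⟫² = ∫G_k‖J_k‖²`. -/
theorem integral_esAction_sub_mul_sq_inner_localField (h2 : 2 ≤ Module.finrank ℝ E)
    (hU0 : ∀ n, U n n = 0) (hUadj : ∀ m n (v w : E), ⟪U m n v, w⟫ = ⟪v, U n m w⟫) (κ S₀ : ℝ)
    (k : Λ) :
    ∫ ω, (esAction κ S₀ U (fun m => ((ω : Λ → sphere (0 : E) 1) m : E)) - S₀) *
        ⟪localField U k (fun m => (ω m : E)), ((ω k : sphere (0 : E) 1) : E)⟫ ^ 2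
          ∂Measure.pi (fun _ : Λ => uniformSphere (volume : Measure E)) =
      (∫ ω, (esAction κ S₀ U (fun m => ((ω : Λ → sphere (0 : E) 1) m : E)) - S₀) *
        ‖localField U k (fun m => (ω m : E))‖ ^ 2
          ∂Measure.pi (fun _ : Λ => uniformSphere (volume : Measure E))) /
        (Module.finrank ℝ E : ℝ) := by
  set μ : Measure (sphere (0 : E) 1) := uniformSphere (volume : Measure E) with hμ
  have hd : (0 : ℝ) < (Module.finrank ℝ E : ℝ) := by exact_mod_cast Module.finrank_pos
  set G : (Λ → E) → ℝ := fun x => esAction κ S₀ U (update x k 0) - S₀ with hG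
  have hGc : ContDiff ℝ 2 G :=
    ((contDiff_esAction U κ S₀).comp
      ((contDiff_update_prod k).comp (contDiff_id.prodMk contDiff_const))).sub contDiff_const
  have hGu : ∀ x y, G (update x k y) = G x := fun x y => by simp only [hG, update_idem]
  have hAG : ∀ x : Λ → E, esAction κ S₀ U x - S₀ = G x - 2 * κ * ⟪localField U k x, x k⟫ :=
    fun x => by
      have h := esAction_update hU0 hUadj κ S₀ x k (x k)
      rw [update_eq_self] at h
      simp only [hG]
      linarith
  have hJc : ContDiff ℝ 2 (localField U k) := contDiff_localField U k
  have hJu : ∀ x y, localField U k (update x k y) = localField U k x := fun x y =>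
    localField_update_self hU0 x k y
  -- (i) the cubic term is odd in `x_k`
  have h3 := integral_inner_localField_pow_three (Λ := Λ) (E := E) hU0 k
  -- (ii) the rank-one quadratic term
  have hq : (Module.finrank ℝ E : ℝ) * ∫ ω, G (fun m => ((ω : Λ → sphere (0 : E) 1) m : E)) *
        ⟪localField U k (fun m => (ω m : E)), ((ω k : sphere (0 : E) 1) : E)⟫ ^ 2
          ∂Measure.pi (fun _ : Λ => μ) =
      ∫ ω, G (fun m => ((ω : Λ → sphere (0 : E) 1) m : E)) * ‖localField U k (fun m => (ω m : E))‖ ^ 2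
          ∂Measure.pi (fun _ : Λ => μ) := by
    have h := integral_site_quadratic (Λ := Λ)
      (F := fun x : Λ → E => G x * ⟪localField U k x, x k⟫ ^ 2)
      (hGc.mul ((hJc.inner ℝ (contDiff_apply ℝ E k)).pow 2)) k
      (fun x => G x • localField U k x) (fun x => localField U k x)
      (hGc.continuous.smul hJc.continuous) hJc.continuous fun x y => by
        simp only [hGu, hJu, update_self, real_inner_smul_left]
        ring
    rw [h]
    refine integral_congr_ae (ae_of_all _ fun ω => ?_)
    dsimp only
    rw [real_inner_smul_left, real_inner_self_eq_norm_sq]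
  -- (iii) the affine term
  have ha : ∫ ω, ⟪localField U k (fun m => ((ω : Λ → sphere (0 : E) 1) m : E)),
        ((ω k : sphere (0 : E) 1) : E)⟫ * ‖localField U k (fun m => (ω m : E))‖ ^ 2
          ∂Measure.pi (fun _ : Λ => μ) = 0 :=
    integral_eq_zero_of_site_affine (Λ := Λ) h2
      (F := fun x : Λ → E => ⟪localField U k x, x k⟫ * ‖localField U k x‖ ^ 2)
      ((hJc.inner ℝ (contDiff_apply ℝ E k)).mul (hJc.norm_sq ℝ)) k
      (fun x => ‖localField U k x‖ ^ 2 • localField U k x) fun x y => by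
        simp only [hJu, update_self, real_inner_smul_left]
        ring
  -- continuity / integrability of the pieces
  have hGs : Continuous fun ω : Λ → sphere (0 : E) 1 => G (fun m => (ω m : E)) :=
    hGc.continuous.comp continuous_sphereConfig
  have hJs : Continuous fun ω : Λ → sphere (0 : E) 1 => localField U k (fun m => (ω m : E)) :=
    hJc.continuous.comp continuous_sphereConfig
  have hPs : Continuous fun ω : Λ → sphere (0 : E) 1 =>
      ⟪localField U k (fun m => (ω m : E)), ((ω k : sphere (0 : E) 1) : E)⟫ :=
    hJs.inner (continuous_subtype_val.comp (continuous_apply k))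
  have hI1 : Integrable (fun ω : Λ → sphere (0 : E) 1 => G (fun m => (ω m : E)) *
      ⟪localField U k (fun m => (ω m : E)), ((ω k : sphere (0 : E) 1) : E)⟫ ^ 2)
      (Measure.pi fun _ : Λ => μ) := integrable_pi_of_continuous μ (hGs.mul (hPs.pow 2))
  have hI2 : Integrable (fun ω : Λ → sphere (0 : E) 1 => 2 * κ *
      ⟪localField U k (fun m => (ω m : E)), ((ω k : sphere (0 : E) 1) : E)⟫ ^ 3)
      (Measure.pi fun _ : Λ => μ) := (integrable_pi_of_continuous μ (hPs.pow 3)).const_mul _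
  have hI3 : Integrable (fun ω : Λ → sphere (0 : E) 1 => G (fun m => (ω m : E)) *
      ‖localField U k (fun m => (ω m : E))‖ ^ 2) (Measure.pi fun _ : Λ => μ) :=
    integrable_pi_of_continuous μ (hGs.mul (hJs.norm.pow 2))
  have hI4 : Integrable (fun ω : Λ → sphere (0 : E) 1 => 2 * κ *
      (⟪localField U k (fun m => (ω m : E)), ((ω k : sphere (0 : E) 1) : E)⟫ *
        ‖localField U k (fun m => (ω m : E))‖ ^ 2)) (Measure.pi fun _ : Λ => μ) :=
    (integrable_pi_of_continuous μ (hPs.mul (hJs.norm.pow 2))).const_mul _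
  -- substitute `S − S₀ = G − 2κ⟪J_k, x_k⟫` on both sides
  have eL : ∫ ω, (esAction κ S₀ U (fun m => ((ω : Λ → sphere (0 : E) 1) m : E)) - S₀) *
        ⟪localField U k (fun m => (ω m : E)), ((ω k : sphere (0 : E) 1) : E)⟫ ^ 2
          ∂Measure.pi (fun _ : Λ => μ) =
      ∫ ω, G (fun m => ((ω : Λ → sphere (0 : E) 1) m : E)) *
        ⟪localField U k (fun m => (ω m : E)), ((ω k : sphere (0 : E) 1) : E)⟫ ^ 2
          ∂Measure.pi (fun _ : Λ => μ) := by
    have hpt : ∀ ω : Λ → sphere (0 : E) 1,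
        (esAction κ S₀ U (fun m => (ω m : E)) - S₀) *
          ⟪localField U k (fun m => (ω m : E)), ((ω k : sphere (0 : E) 1) : E)⟫ ^ 2 =
        G (fun m => (ω m : E)) * ⟪localField U k (fun m => (ω m : E)), ((ω k : sphere (0 : E) 1) : E)⟫ ^ 2 -
          2 * κ * ⟪localField U k (fun m => (ω m : E)), ((ω k : sphere (0 : E) 1) : E)⟫ ^ 3 :=
      fun ω => by rw [hAG]; ring
    simp_rw [hpt]
    rw [integral_sub hI1 hI2, integral_const_mul, h3, mul_zero, sub_zero]
  have eR : ∫ ω, (esAction κ S₀ U (fun m => ((ω : Λ → sphere (0 : E) 1) m : E)) - S₀) *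
        ‖localField U k (fun m => (ω m : E))‖ ^ 2 ∂Measure.pi (fun _ : Λ => μ) =
      ∫ ω, G (fun m => ((ω : Λ → sphere (0 : E) 1) m : E)) * ‖localField U k (fun m => (ω m : E))‖ ^ 2
          ∂Measure.pi (fun _ : Λ => μ) := by
    have hpt : ∀ ω : Λ → sphere (0 : E) 1,
        (esAction κ S₀ U (fun m => (ω m : E)) - S₀) * ‖localField U k (fun m => (ω m : E))‖ ^ 2 =
        G (fun m => (ω m : E)) * ‖localField U k (fun m => (ω m : E))‖ ^ 2 -
          2 * κ * (⟪localField U k (fun m => (ω m : E)), ((ω k : sphere (0 : E) 1) : E)⟫ *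
            ‖localField U k (fun m => (ω m : E))‖ ^ 2) := fun ω => by rw [hAG]; ring
    simp_rw [hpt]
    rw [integral_sub hI3 hI4, integral_const_mul, ha, mul_zero, sub_zero]
  rw [eL, eR, ← hq, mul_div_cancel_left₀ _ hd.ne']

end PerSite

end Summit.Ventures.LatticeQCDFlow.Exactness

end
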